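import Summits.QuantumFields.YangMills.Theorems.LuscherReductionOneSiteLevelsGnHaar
import Summits.QuantumFields.YangMills.Theorems.LuscherReductionDressedRitzPolyakovLiftTransplantDilation
import Mathlib.MeasureTheory.Measure.Haar.InnerProductSpace
import HarnessLib

/-!
# Line «polyakovlift» r6 on crux `DressedRitz` (stmt-QuantumFields-20205), W2-F8c: the configurations with an EQUATORIAL `L`-th power are Haar-null

Fleet-service module of seat ym-infvol-p1 g7.  The registered shadow observables `g_i ∘ powLink L`, `g_i = transplantFn R f i ∘ rootCoord L (Λ/2)`, are read through
the gnomonic chart, which carries a junk value on the equator `scalarPart = 0` (`x/0 = 0`): there `g_i` jumps (design note of the seat, 2026-08-27), so the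
everywhere-Lipschitz form of F8c is stated for the regularised observable that vanishes whenever some `U_j^L` is equatorial.  This file proves that the
regularisation changes nothing almost everywhere:

* `haar_scalarPart_eq_null` — every level set `{W : scalarPart W = c}` of `SU(2)` is Haar-null (gnomonic decomposition of Haar `haarProbability_su2_eq_gnomonic` +
  Lebesgue-null Euclidean spheres);
* `exists_poly_powSeq` / `exists_poly_scalarPart_pow` — `scalarPart (W^L) = T_L(scalarPart W)` for a non-zero polynomial `T_L` (`scalarPart_pow_vecPart_pow`, `T_L(1) = 1`);
* ★ `haar_scalarPart_pow_eq_zero_null` — `Haar{W : scalarPart (W^L) = 0} = 0`;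
* ★★ `configMeasure_equatorialPow_null` — `configMeasure SU2 1 {U : ∃ j, scalarPart ((U (edgeOf j))^L) = 0} = 0` (product measure, `Measure.pi_eval_preimage_null`).

HONEST FRAMING: measure-zero bookkeeping for ONE soft-error estimate of ONE one-site stub of a conditional crux on the femto rung R2b1; not infinite volume,
not a gap, not Clay.  References: Bröcker–tom Dieck [cite: BrockerTomDieck1985, I (1.10), IV (2.2)]; M. Lüscher, NPB 219 (1983) 233 [cite: Luscher1983, §2].
-/

set_option autoImplicit false

noncomputable section

open MeasureTheory Filter Topology Real Set
open Literature.MathematicalPhysics.QuantumFieldTheory (GaugeConfig Site gaugeTransform haarProbability)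
open Literature.MathematicalPhysics.QuantumLattice
open Literature.MathematicalPhysics.QuantumFieldTheory.Balaban1983to89.T4CubeChartGnomonic (gnoPoint continuous_gnoPoint)
open scoped BigOperators ENNReal

namespace Summit.QuantumFields.YangMills.Theorems.FemtoTransferGap.PolyakovLift

open Summit.QuantumFields.YangMills.Theorems.FemtoTransferGap

/-! ## §1 Level sets of the scalar part are Haar-null -/

/-- A Euclidean sphere `{v : Σ_a v_a² = ρ}` in `ℝ³` (product coordinates) is Lebesgue-null. [folklore] -/
theorem volume_sumSq_eq_null (ρ : ℝ) : (volume : Measure (Fin 3 → ℝ)) {v | ∑ a, v a ^ 2 = ρ} = 0 := by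
  by_cases hρ : ρ < 0
  · have : {v : Fin 3 → ℝ | ∑ a, v a ^ 2 = ρ} = ∅ := by
      ext v
      simp only [mem_setOf_eq, mem_empty_iff_false, iff_false]
      intro h
      have : 0 ≤ ∑ a, v a ^ 2 := Finset.sum_nonneg fun _ _ => sq_nonneg _
      linarith
    rw [this, measure_empty]
  have hρ0 : 0 ≤ ρ := not_lt.1 hρ
  have hset : {v : Fin 3 → ℝ | ∑ a, v a ^ 2 = ρ} = (WithLp.toLp 2) ⁻¹' Metric.sphere (0 : EuclideanSpace ℝ (Fin 3)) (Real.sqrt ρ) := by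
    ext v
    simp only [mem_setOf_eq, mem_preimage, Metric.mem_sphere, dist_zero_right]
    rw [EuclideanSpace.norm_eq]
    have e : ∑ a, ‖(WithLp.toLp 2 v : EuclideanSpace ℝ (Fin 3)) a‖ ^ 2 = ∑ a, v a ^ 2 :=
      Finset.sum_congr rfl fun a _ => by rw [Real.norm_eq_abs, sq_abs]
    rw [e]
    constructor
    · intro h; rw [h]
    · intro h
      have := congrArg (fun t => t ^ 2) h
      rwa [Real.sq_sqrt (Finset.sum_nonneg fun _ _ => sq_nonneg _), Real.sq_sqrt hρ0] at this
  rw [hset, (PiLp.volume_preserving_toLp (Fin 3)).measure_preimage Metric.isClosed_sphere.measurableSet.nullMeasurableSet]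
  exact Measure.addHaar_sphere volume _ _

/-- `gnoDensityMeasure ≪ volume`. [folklore] -/
theorem gnoDensityMeasure_absolutelyContinuous : gnoDensityMeasure ≪ (volume : Measure (Fin 3 → ℝ)) :=
  withDensity_absolutelyContinuous _ _

/-- The chart preimage of a level set of the scalar part lies in a Euclidean sphere: `scalarPart (P(1,v)) = c ⇒ Σ v² = 1/c² − 1`. [cite: BrockerTomDieck1985, I (1.10)] -/
theorem sumSq_eq_of_scalarPart_gnoPoint {v : Fin 3 → ℝ} {c : ℝ} (h : scalarPart (gnoPoint v) = c) : ∑ a, v a ^ 2 = 1 / c ^ 2 - 1 := by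
  rw [scalarPart_gnoPoint] at h
  have hq : ‖gnomonicQuat v‖ ^ 2 = 1 + ∑ i, v i ^ 2 := sq_norm_gnomonicQuat v
  have hpos : 0 < ‖gnomonicQuat v‖ := norm_pos_iff.2 (gnomonicQuat_ne_zero v)
  rw [← h, inv_pow, one_div, inv_inv, hq]
  ring

/-- **Every level set of the scalar part is Haar-null.** [cite: BrockerTomDieck1985, IV (2.2)] -/
theorem haar_scalarPart_eq_null (c : ℝ) : haarProbability SU2 {W | scalarPart W = c} = 0 := by
  haveI := secondCountableTopology_su2
  have hS : MeasurableSet {W : SU2 | scalarPart W = c} := measurableSet_eq_fun continuous_scalarPart.measurable measurable_const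
  have hm2 : Measurable fun v : Fin 3 → ℝ => negOne * gnoPoint v := (continuous_const.mul continuous_gnoPoint).measurable
  rw [haarProbability_su2_eq_gnomonic, Measure.add_apply,
    Measure.map_apply continuous_gnoPoint.measurable hS, Measure.map_apply hm2 hS]
  have h1 : gnoDensityMeasure (gnoPoint ⁻¹' {W : SU2 | scalarPart W = c}) = 0 := by
    refine gnoDensityMeasure_absolutelyContinuous (measure_mono_null (fun v hv => ?_) (volume_sumSq_eq_null (1 / c ^ 2 - 1)))
    exact sumSq_eq_of_scalarPart_gnoPoint hv
  have h2 : gnoDensityMeasure ((fun v => negOne * gnoPoint v) ⁻¹' {W : SU2 | scalarPart W = c}) = 0 := by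
    refine gnoDensityMeasure_absolutelyContinuous (measure_mono_null (fun v hv => ?_) (volume_sumSq_eq_null (1 / (-c) ^ 2 - 1)))
    have hv' : scalarPart (negOne * gnoPoint v) = c := hv
    rw [scalarPart_negOne_mul] at hv'
    exact sumSq_eq_of_scalarPart_gnoPoint (c := -c) (by linarith)
  rw [h1, h2, add_zero]

/-! ## §2 `scalarPart (W^L)` is a polynomial in `scalarPart W` -/

/-- The Chebyshev recursion of `powSeq u (1 − u²)` is polynomial in `u`: there are polynomials `T_m, S_m` with `T_m(u) = (powSeq u (1−u²) m).1`,
`S_m(u) = (powSeq u (1−u²) m).2` and `T_m(1) = 1` (`(T_{m+1}, S_{m+1}) = (T_m·X − S_m·(1 − X²), T_m + X·S_m)`). [cite: BrockerTomDieck1985, I (1.10)] -/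
theorem exists_poly_powSeq (m : ℕ) : ∃ p q : Polynomial ℝ,
    (∀ u : ℝ, p.eval u = (powSeq u (1 - u ^ 2) m).1) ∧ (∀ u : ℝ, q.eval u = (powSeq u (1 - u ^ 2) m).2) ∧ p.eval 1 = 1 := by
  induction m with
  | zero => exact ⟨1, 0, fun u => by simp [powSeq], fun u => by simp [powSeq], by simp⟩
  | succ m ih =>
    obtain ⟨p, q, hp, hq, hp1⟩ := ih
    refine ⟨p * Polynomial.X - q * (1 - Polynomial.X ^ 2), p + Polynomial.X * q, fun u => ?_, fun u => ?_, ?_⟩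
    · rw [powSeq_succ]
      simp [Polynomial.eval_mul, Polynomial.eval_sub, Polynomial.eval_pow, Polynomial.eval_X, hp u, hq u]
    · rw [powSeq_succ]
      simp [Polynomial.eval_mul, Polynomial.eval_add, Polynomial.eval_X, hp u, hq u]
    · simp [Polynomial.eval_mul, Polynomial.eval_sub, Polynomial.eval_pow, Polynomial.eval_X, hp1]

/-- `scalarPart (W^L) = T_L(scalarPart W)` for a NON-ZERO polynomial `T_L`. [cite: BrockerTomDieck1985, I (1.10)] -/
theorem exists_poly_scalarPart_pow (L : ℕ) : ∃ p : Polynomial ℝ, p ≠ 0 ∧ ∀ W : SU2, scalarPart (W ^ L) = p.eval (scalarPart W) := by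
  obtain ⟨p, q, hp, -, hp1⟩ := exists_poly_powSeq L
  refine ⟨p, fun h => ?_, fun W => ?_⟩
  · rw [h, Polynomial.eval_zero] at hp1; exact zero_ne_one hp1
  · have h := (scalarPart_pow_vecPart_pow W L).1
    rw [sum_vecPart_sq] at h
    rw [h, hp]

/-- ★ **`Haar{W : scalarPart (W^L) = 0} = 0`**: the zero set of `T_L ∘ scalarPart` is a finite union of level sets. [cite: BrockerTomDieck1985, IV (2.2)] -/
theorem haar_scalarPart_pow_eq_zero_null (L : ℕ) : haarProbability SU2 {W | scalarPart (W ^ L) = 0} = 0 := by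
  classical
  obtain ⟨p, hp0, hp⟩ := exists_poly_scalarPart_pow L
  have hsub : {W : SU2 | scalarPart (W ^ L) = 0} ⊆ ⋃ c ∈ p.roots.toFinset, {W : SU2 | scalarPart W = c} := by
    intro W hW
    have hW' : p.eval (scalarPart W) = 0 := by rw [← hp]; exact hW
    refine mem_iUnion₂.2 ⟨scalarPart W, ?_, rfl⟩
    rw [Multiset.mem_toFinset, Polynomial.mem_roots hp0]
    exact hW'
  refine measure_mono_null hsub ?_
  exact (measure_biUnion_null_iff (p.roots.toFinset.countable_toSet)).2 fun c _ => haar_scalarPart_eq_null c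

/-! ## §3 The one-site configurations with an equatorial `L`-th power are null -/

/-- ★★ **`configMeasure SU2 1 {U : ∃ j, scalarPart ((U (edgeOf j))^L) = 0} = 0`** (product of Haar measures; one null coordinate condition at a time).
[cite: BrockerTomDieck1985, IV (2.2)] -/
theorem configMeasure_equatorialPow_null (L : ℕ) :
    configMeasure SU2 1 {U : Cfg | ∃ j : Fin 3, scalarPart ((U (edgeOf j)) ^ L) = 0} = 0 := by
  have hsub : {U : Cfg | ∃ j : Fin 3, scalarPart ((U (edgeOf j)) ^ L) = 0} ⊆
      ⋃ j : Fin 3, Function.eval (edgeOf j) ⁻¹' {W : SU2 | scalarPart (W ^ L) = 0} := by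
    intro U hU
    obtain ⟨j, hj⟩ := hU
    exact mem_iUnion.2 ⟨j, hj⟩
  refine measure_mono_null hsub ((measure_iUnion_null_iff).2 fun j => ?_)
  unfold configMeasure
  exact Measure.pi_eval_preimage_null (μ := fun _ : Literature.MathematicalPhysics.QuantumFieldTheory.Edge 3 1 => haarProbability SU2)
    (haar_scalarPart_pow_eq_zero_null L)

end Summit.QuantumFields.YangMills.Theorems.FemtoTransferGap.PolyakovLift

end
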